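import Mathlib
import HarnessLib
import Literature.MathematicalPhysics.QuantumLattice.GrassmannEffectiveActionTruncationDB
import Summits.HubbardSuperconductivity.HubbardSuperconductivity.Theorems.KLProgrammeKLRegimeEngineScaleZeroTransfer
import Summits.HubbardSuperconductivity.HubbardSuperconductivity.Theorems.KLProgrammeC4aSecondCumulantDegree

/-!
# K3 ENGINE-FLOW child (stmt-HubbardSuperconductivity-20437 `KLRegimeEngineV17F2`), located «(X).2′-BASE-ROOM», cure (β) «SCALE0-MEMBER-DIFF», part F4a:
# THE GRADED PINNED PROFILE OF THE THIRD-ORDER TAIL `T₃` OF THE GRID SCALE-`0` ACTION — `ρ^{-2m′}·A·θ^{max(2, m′−2)}`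

Cell `gate-hubbard-kl`, seat hubbard-kl-k3c5-p1 (g22).  With `Ṽ = V_N + 𝒩_{K,N}` on the grid and `C′ = SᵀC^K_{>e₀}S` (k3c2-p1 g5's step data:
`IsGramBoundedR C′ κ`, row/column sums `α`, counterterm size `N₁`, field weight `ρ`, `θ = eα‖Ṽ‖_h/κ² < 1`), the tail
`T₃ = effAction C′ Ṽ − e^{Δ_{C′}}Ṽ + ½(e^{Δ_{C′}}(Ṽ·Ṽ) − e^{Δ_{C′}}Ṽ·e^{Δ_{C′}}Ṽ)` of the `n₀ = 3` truncation has pinned kernel norms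
`Σ_{Y : Y_j = w} ‖kernel_{2m′} T₃ (Y)‖ ≤ ρ^{-2m′}·A·θ^{max(2, m′−2)}`, `A = e‖Ṽ‖_h/(1−θ)` (**`scaleZero_tail_pinned_le`**): degrees `≤ 6` by the truncation
(`GrassmannEffectiveActionTruncationDB.sum_norm_kernel_effAction_sub_secondOrder_le_of_gramBounded`, `θ²`), degrees `≥ 8` are those of `effAction C′ Ṽ` itself
(`GrassmannEffectiveActionGradedDB.…_quartic`, `θ^{m′−2}`) because `e^{Δ}Ṽ` has degree `≤ 4` and the second cumulant degree `≤ 6`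
(`kernel_secondCumulant_eq_zero_of_six_lt`, from c4a-1's cross-contraction form).  Companion `…SmearingTail` feeds this profile to k3c1-p1 g14's two-level
binomial–Gram values lemma `klmg_vertexFn_map_gaussConv_sub_le_binomial₂`.  Nothing here asserts row (X), any stub, K3, U₀ or superconductivity.
References: BGM 2006 (2.13)–(2.14), (2.77)–(2.80), (2.86)–(2.90) [cite: BenfattoGiulianiMastropietro2006]; Pedra–Salmhofer 2008 Thm 2.4 [cite: PedraSalmhofer2008].
-/

noncomputable section

namespace Summit.HubbardSuperconductivity.HubbardSuperconductivity.Theorems.EngineV8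

set_option linter.dupNamespace false -- summit = problem name (single-conjunct summit), D-0017

open Real Finset Literature.MathematicalPhysics.QuantumLattice Literature.Probability.LatticeModels
open Literature.MathematicalPhysics.QuantumLattice.GrassmannAlgebra GrassmannAlgebra
open Summit.HubbardSuperconductivity.HubbardSuperconductivity.Theorems.KLRegimeSplit
open Summit.HubbardSuperconductivity.HubbardSuperconductivity.Theorems.KLRegimeWick
open Summit.HubbardSuperconductivity.HubbardSuperconductivity.Theorems.C4a

/-! ## §1 Generic: the second cumulant of a quartic has degree `≤ 6` -/

section Generic

variable {Γ : Type*} [Fintype Γ] [DecidableEq Γ]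

/-- **The second cumulant of an even element of degree `≤ 4` has no kernels of degree `> 6`**: with `W̃ = e^{Δ_C}W`,
`e^{Δ_C}(W·W) − e^{Δ_C}W·e^{Δ_C}W = dblFold((e^{Δ_×} − 1)(W̃⁰W̃¹))` and `e^{Δ_×} − 1` consumes at least two of the `≤ 8` fields. [cite: Salmhofer1999, §2.3 (2.53)] -/
theorem kernel_secondCumulant_eq_zero_of_six_lt (C : Matrix Γ Γ ℂ) {W : GrassmannAlgebra ℂ Γ} (hW : W ∈ evenOdd ℂ 0)
    (hW4 : ∀ j, 4 < j → ∀ Y : Fin j → Γ, kernel ℂ W j Y = 0) {j : ℕ} (hj : 6 < j) (Y : Fin j → Γ) :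
    kernel ℂ (gaussConv ℂ C (W * W) - gaussConv ℂ C W * gaussConv ℂ C W) j Y = 0 := by
  have hWt4 : ∀ j', 4 < j' → ∀ Y' : Fin j' → Γ, kernel ℂ (gaussConv ℂ C W) j' Y' = 0 := fun j' hj' Y' =>
    kernel_gaussConv_eq_zero_of_degree ℂ C hW4 hj' Y'
  have hT8 : ∀ j', 8 < j' → ∀ Z : Fin j' → Γ × Fin 2,
      kernel ℂ (dblCopy ℂ 0 (gaussConv ℂ C W) * dblCopy ℂ 1 (gaussConv ℂ C W)) j' Z = 0 := fun j' hj' Z =>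
    kernel_copy_mul_copy_eq_zero_of_degree (dA := 4) (dB := 4) hWt4 hWt4 (by omega) Z
  rw [secondCumulant_eq_dblFold_cross ℂ C hW, kernel_dblFold]
  refine Finset.sum_eq_zero fun s _ => ?_
  rw [LinearMap.sub_apply, Module.End.one_apply,
    kernel_gaussConv_sub_self_eq ℂ (crossCov ℂ C) (fun j' hj' Z => hT8 j' (by omega) Z) _,
    kernel_grassmannLaplacian_eq_zero_of ℂ _ (fun Z => hT8 (j + 2) (by omega) Z) _,
    kernel_grassmannLaplacian_eq_zero_of ℂ _ (fun Z => kernel_grassmannLaplacian_eq_zero_of ℂ _ (fun Z' => hT8 (j + 2 + 2) (by omega) Z') Z) _,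
    mul_zero, add_zero]

end Generic

/-! ## §2 The graded pinned profile of the tail on the grid -/

section Grid

variable {L M : ℕ} [NeZero L]

/-- **The graded pinned profile of `T₃`** in k3c2-p1 g5's grid step data (`N = 4M`, `S = hubbardGridSub … N`, `C′ = SᵀC^K_{>e₀}S`, `Ṽ = V_N + 𝒩_{K,N}`,
`θ = eα‖Ṽ‖_h/κ² < 1`, `A = e‖Ṽ‖_h/(1−θ)`): `T₃` is even and `Σ_{Y : Y_j = w} ‖kernel_{2m′} T₃ (Y)‖ ≤ ρ^{-2m′}·A·θ^{max(2, m′−2)}` for every `m′`.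
[cite: BenfattoGiulianiMastropietro2006, (2.13)-(2.14) and (2.86)-(2.90)] -/
theorem scaleZero_tail_pinned_le [NeZero M] {β : ℝ} (U μ : ℝ) (K : TrigPolyC4v) {κ : ℝ} (hκ : 0 < κ)
    (hGB : IsGramBoundedR ((hubbardGridSub L M β (2 * (2 * M))).transpose * hubbardCovAboveCT L M β μ 0 K klE0 *
      hubbardGridSub L M β (2 * (2 * M))) κ)
    {α : ℝ} (hα : 0 < α)
    (hrow : ∀ X, ∑ Y, ‖((hubbardGridSub L M β (2 * (2 * M))).transpose * hubbardCovAboveCT L M β μ 0 K klE0 *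
      hubbardGridSub L M β (2 * (2 * M))) X Y‖ ≤ α)
    (hcol : ∀ Y, ∑ X, ‖((hubbardGridSub L M β (2 * (2 * M))).transpose * hubbardCovAboveCT L M β μ 0 K klE0 *
      hubbardGridSub L M β (2 * (2 * M))) X Y‖ ≤ α)
    {ρ : ℝ} (hρ : 0 < ρ) {N₁ : ℝ} (hN₁ : 0 ≤ N₁)
    (hct : ∀ (j : Fin 2) (w : GridLeg (GridPoint L (2 * (2 * M)))),
      ∑ Y ∈ univ.filter (fun Y : Fin 2 → GridLeg (GridPoint L (2 * (2 * M))) => Y j = w),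
        ‖kernel ℂ (hubbardGridCounterQuadratic L (2 * (2 * M)) β K) 2 Y‖ ≤ N₁)
    (hθ : Real.exp 1 * α * normV (GridLeg (GridPoint L (2 * (2 * M)))) κ ρ
      (fun m' : ℕ => if m' = 1 then N₁ else if m' = 2 then |U| * |β| / (2 * (2 * M) : ℕ) else 0) / κ ^ 2 < 1) :
    (effAction ℂ ((hubbardGridSub L M β (2 * (2 * M))).transpose * hubbardCovAboveCT L M β μ 0 K klE0 * hubbardGridSub L M β (2 * (2 * M)))
          (hubbardGridInteraction L (2 * (2 * M)) β U + hubbardGridCounterQuadratic L (2 * (2 * M)) β K) -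
        gaussConv ℂ ((hubbardGridSub L M β (2 * (2 * M))).transpose * hubbardCovAboveCT L M β μ 0 K klE0 * hubbardGridSub L M β (2 * (2 * M)))
          (hubbardGridInteraction L (2 * (2 * M)) β U + hubbardGridCounterQuadratic L (2 * (2 * M)) β K) +
        (2 : ℂ)⁻¹ • (gaussConv ℂ ((hubbardGridSub L M β (2 * (2 * M))).transpose * hubbardCovAboveCT L M β μ 0 K klE0 * hubbardGridSub L M β (2 * (2 * M)))
            ((hubbardGridInteraction L (2 * (2 * M)) β U + hubbardGridCounterQuadratic L (2 * (2 * M)) β K) *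
              (hubbardGridInteraction L (2 * (2 * M)) β U + hubbardGridCounterQuadratic L (2 * (2 * M)) β K)) -
          gaussConv ℂ ((hubbardGridSub L M β (2 * (2 * M))).transpose * hubbardCovAboveCT L M β μ 0 K klE0 * hubbardGridSub L M β (2 * (2 * M)))
              (hubbardGridInteraction L (2 * (2 * M)) β U + hubbardGridCounterQuadratic L (2 * (2 * M)) β K) *
            gaussConv ℂ ((hubbardGridSub L M β (2 * (2 * M))).transpose * hubbardCovAboveCT L M β μ 0 K klE0 * hubbardGridSub L M β (2 * (2 * M)))
              (hubbardGridInteraction L (2 * (2 * M)) β U + hubbardGridCounterQuadratic L (2 * (2 * M)) β K)) ∈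
        evenPart ℂ (GridLeg (GridPoint L (2 * (2 * M))))) ∧
      ∀ (m' : ℕ) (j : Fin (2 * m')) (w : GridLeg (GridPoint L (2 * (2 * M)))),
        ∑ Y ∈ univ.filter (fun Y : Fin (2 * m') → GridLeg (GridPoint L (2 * (2 * M))) => Y j = w),
          ‖kernel ℂ
            (effAction ℂ ((hubbardGridSub L M β (2 * (2 * M))).transpose * hubbardCovAboveCT L M β μ 0 K klE0 * hubbardGridSub L M β (2 * (2 * M)))
                (hubbardGridInteraction L (2 * (2 * M)) β U + hubbardGridCounterQuadratic L (2 * (2 * M)) β K) -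
              gaussConv ℂ ((hubbardGridSub L M β (2 * (2 * M))).transpose * hubbardCovAboveCT L M β μ 0 K klE0 * hubbardGridSub L M β (2 * (2 * M)))
                (hubbardGridInteraction L (2 * (2 * M)) β U + hubbardGridCounterQuadratic L (2 * (2 * M)) β K) +
              (2 : ℂ)⁻¹ • (gaussConv ℂ ((hubbardGridSub L M β (2 * (2 * M))).transpose * hubbardCovAboveCT L M β μ 0 K klE0 * hubbardGridSub L M β (2 * (2 * M)))
                  ((hubbardGridInteraction L (2 * (2 * M)) β U + hubbardGridCounterQuadratic L (2 * (2 * M)) β K) *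
                    (hubbardGridInteraction L (2 * (2 * M)) β U + hubbardGridCounterQuadratic L (2 * (2 * M)) β K)) -
                gaussConv ℂ ((hubbardGridSub L M β (2 * (2 * M))).transpose * hubbardCovAboveCT L M β μ 0 K klE0 * hubbardGridSub L M β (2 * (2 * M)))
                    (hubbardGridInteraction L (2 * (2 * M)) β U + hubbardGridCounterQuadratic L (2 * (2 * M)) β K) *
                  gaussConv ℂ ((hubbardGridSub L M β (2 * (2 * M))).transpose * hubbardCovAboveCT L M β μ 0 K klE0 * hubbardGridSub L M β (2 * (2 * M)))
                    (hubbardGridInteraction L (2 * (2 * M)) β U + hubbardGridCounterQuadratic L (2 * (2 * M)) β K)))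
            (2 * m') Y‖ ≤
          ρ⁻¹ ^ (2 * m') *
            (Real.exp 1 * normV (GridLeg (GridPoint L (2 * (2 * M)))) κ ρ
                (fun m' : ℕ => if m' = 1 then N₁ else if m' = 2 then |U| * |β| / (2 * (2 * M) : ℕ) else 0) /
              (1 - Real.exp 1 * α * normV (GridLeg (GridPoint L (2 * (2 * M)))) κ ρ
                (fun m' : ℕ => if m' = 1 then N₁ else if m' = 2 then |U| * |β| / (2 * (2 * M) : ℕ) else 0) / κ ^ 2)) *
            (Real.exp 1 * α * normV (GridLeg (GridPoint L (2 * (2 * M)))) κ ρ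
                (fun m' : ℕ => if m' = 1 then N₁ else if m' = 2 then |U| * |β| / (2 * (2 * M) : ℕ) else 0) / κ ^ 2) ^ max 2 (m' - 2) := by
  -- notation
  set Ng : ℕ := 2 * (2 * M) with hNg
  haveI : NeZero Ng := ⟨by rw [hNg]; have := NeZero.ne M; omega⟩
  set S := hubbardGridSub L M β Ng with hS
  set C' := S.transpose * hubbardCovAboveCT L M β μ 0 K klE0 * S with hC'
  set Vt := hubbardGridInteraction L Ng β U + hubbardGridCounterQuadratic L Ng β K with hVt
  set prof : ℕ → ℝ := fun m' : ℕ => if m' = 1 then N₁ else if m' = 2 then |U| * |β| / Ng else 0 with hprof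
  set nV : ℝ := normV (GridLeg (GridPoint L Ng)) κ ρ prof with hnV
  set θ : ℝ := Real.exp 1 * α * nV / κ ^ 2 with hθdef
  set A : ℝ := Real.exp 1 * nV / (1 - θ) with hA
  have hnV0 : 0 ≤ nV := by rw [hnV]; exact normV_nonneg hκ.le hρ.le (klsv_profile_nonneg β U Ng hN₁)
  have hθ0 : 0 ≤ θ := by positivity
  have hθ1 : θ < 1 := hθ
  -- parity and degrees of `Ṽ`
  have hVt_even : Vt ∈ evenPart ℂ (GridLeg (GridPoint L Ng)) :=
    add_mem (hubbardGridInteraction_mem_evenPart β U) (hubbardGridCounterQuadratic_mem_evenPart β K)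
  have hVt0 : constPart ℂ Vt = 0 := by
    rw [hVt, map_add, constPart_hubbardGridInteraction, constPart_hubbardGridCounterQuadratic, add_zero]
  have hdeg : ∀ m'', 2 < m'' → ∀ Y : Fin (2 * m'') → GridLeg (GridPoint L Ng), kernel ℂ Vt (2 * m'') Y = 0 := fun m'' hm'' Y => by
    rw [hVt, kernel_add, kernel_hubbardGridInteraction_of_ne β U (by omega) Y, kernel_hubbardGridCounterQuadratic_of_ne β K (by omega) Y, add_zero]
  have hdeg4 : ∀ j, 4 < j → ∀ Y : Fin j → GridLeg (GridPoint L Ng), kernel ℂ Vt j Y = 0 := fun j hj Y => by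
    rw [hVt, kernel_add, kernel_hubbardGridInteraction_of_ne β U (by omega) Y, kernel_hubbardGridCounterQuadratic_of_ne β K (by omega) Y, add_zero]
  set F := effAction ℂ C' Vt with hF
  set E₁ := gaussConv ℂ C' Vt with hE₁
  set E₂' := gaussConv ℂ C' (Vt * Vt) - gaussConv ℂ C' Vt * gaussConv ℂ C' Vt with hE₂'
  have hF_even : F ∈ evenPart ℂ (GridLeg (GridPoint L Ng)) := effAction_mem_evenPart C' hVt_even hVt0
  have hE₁_even : E₁ ∈ evenPart ℂ (GridLeg (GridPoint L Ng)) := (mem_evenPart_iff).2 (gaussConv_mem_evenOdd ℂ C' ((mem_evenPart_iff).1 hVt_even))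
  have hE₂_even : E₂' ∈ evenPart ℂ (GridLeg (GridPoint L Ng)) := by
    refine sub_mem ((mem_evenPart_iff).2 (gaussConv_mem_evenOdd ℂ C' ?_)) (mul_mem hE₁_even hE₁_even)
    exact (mem_evenPart_iff).1 (mul_mem hVt_even hVt_even)
  refine ⟨add_mem (sub_mem hF_even hE₁_even) (Submodule.smul_mem _ _ hE₂_even), fun m' j w => ?_⟩
  rcases Nat.lt_or_ge m' 4 with hm | hm
  · -- degrees `2, 4, 6`: the `n₀ = 3` truncation
    have hm0 : 0 < 2 * m' := by have := j.2; omega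
    have h := (sum_norm_kernel_effAction_sub_secondOrder_le_of_gramBounded C' hκ hGB Vt hVt_even hVt0 prof (klsv_profile_nonneg β U Ng hN₁)
      (klsv_sum_norm_kernel_gridVertex_le β U K hN₁ hct) hα hrow hcol hρ hθ).2 hm0 j w
    refine h.trans (le_of_eq ?_)
    have hmax : max 2 (m' - 2) = 2 := by omega
    rw [hmax, hA]
    ring
  · -- degrees `≥ 8`: the tail is the action itself there
    have hm8 : 6 < 2 * m' := by omega
    have hvan : ∀ Y : Fin (2 * m') → GridLeg (GridPoint L Ng), kernel ℂ (F - E₁ + (2 : ℂ)⁻¹ • E₂') (2 * m') Y = kernel ℂ F (2 * m') Y := by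
      intro Y
      rw [kernel_add, kernel_sub_gen, kernel_smul, hE₁, kernel_gaussConv_eq_zero_of_degree ℂ C' hdeg4 (by omega) Y, hE₂',
        kernel_secondCumulant_eq_zero_of_six_lt C' ((mem_evenPart_iff).1 hVt_even) hdeg4 hm8 Y, sub_zero, mul_zero, add_zero]
    rw [sum_congr rfl fun Y _ => by rw [hvan Y]]
    have h := (sum_norm_kernel_effAction_le_pow_of_gramBounded_quartic C' hκ hGB Vt hVt_even hVt0 prof (klsv_profile_nonneg β U Ng hN₁)
      (klsv_sum_norm_kernel_gridVertex_le β U K hN₁ hct) hdeg hα hrow hcol hρ hθ (p := m') (by omega) j w).2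
    refine h.trans (le_of_eq ?_)
    have hmax : max 2 (m' - 2) = m' - 2 := by omega
    rw [hmax, hA]
    ring

end Grid

end Summit.HubbardSuperconductivity.HubbardSuperconductivity.Theorems.EngineV8

end
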